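/-
Origin: expansion seat `prover-pub-hodgecm-mc-binder-2-g17-0`, handover #89 2026-08-20T19:40Z md5 479f57c1cd6c (NEW; 117 l.; ns `HodgeCM.IsotypicSummand.Rep`; the REPRESENTATION form (tower reading of (α4), `ℂ[G(𝔸_f)]`-modules as Mathlib `Representation` ∕ `Subrepresentation` ∕ `IntertwiningMap`, house style of `Literature/…/IrreducibleClasses`; matches sinst-1's private `adelicThetaRep : Representation ℂ Gf …` a5b78762a241): adapters `subtype` ∕ `subtypeAsModule` ∕ `asSubmoduleEquiv : H.toRepresentation.asModule ≃ₗ[k[G]] ↥H.asSubmodule` ∕ `isSimpleModule_asSubmodule` ∕ `equivOfLinearEquivAsModule`; MAIN `range_le_of_isInternal (hH : DirectSum.IsInternal fun i => (H i).toSubmodule) [∀ i, (H i).toRepresentation.IsIrreducible] [σ.IsIrreducible] (hS : ∀ i, Nonempty (σ.Equiv (H i).toRepresentation) → i = i₀) (f : IntertwiningMap σ ρ) : f.range ≤ H i₀`, `apply_mem_of_isInternal`, `range_le_of_isInternal_of_equiv` (pairwise non-equivalent summands + `e : σ.Equiv (H i₀).toRepresentation`), block form `range_le_biSup_of_isInternal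 : (f j).range.toSubmodule ≤ ⨆ i ∈ B, (H i).toSubmodule`. Bridges = Mathlib only (`Representation.irreducible_iff_isSimpleModule_asModule`, `Subrepresentation.asSubmodule`, `IntertwiningMap.equivLinearMapAsModule`, `IntertwiningMap.ofBijective`). CERT lane farm rc 0 ∕ 3 s ∕ 0 warn ∕ proof holes 0; `#print axioms` 9 ∕ 9 ⊆ trio (`g17/farm/logs/ax_isorep.log` 73b54c018c6a); FQN 0 collisions; NAME LIST: `HodgeCM.IsotypicSummand.Rep.range_le_of_isInternal` · `HodgeCM.IsotypicSummand.Rep.range_le_of_isInternal_of_equiv` · `HodgeCM.IsotypicSummand.Rep.range_le_biSup_of_isInternal`) (`HOME/mc/pub-hodgecm-mc-binder-2/g17/stage61/HodgeCM/Model/Binders/IsotypicSummandRep.lean`, md5 479f57c1cd6c, 117 lines);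
landed by the gen-25 packager (p-g25) in gate run 61 as `HodgeCM/Model/Binders/IsotypicSummandRep.lean` (verbatim).
-/
/-
binder-2 lane (unit pub-hodgecm-mc-binder-2-g17, seat prover-pub-hodgecm-mc-binder-2-g17-0), 2026-08-20.
(J-Liu-Θ) junction behind E's row 9 `hΘ` — offer (O3), REPRESENTATION-LEVEL form (tower reading of (α4):
`ℂ[G(𝔸_F^∞)]`-modules as Mathlib `Representation`s / `Subrepresentation`s / `IntertwiningMap`s, the house style of
`Literature/NumberTheory/Automorphic/IrreducibleClasses`).  Imports Mathlib + the module-level leaf only.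
No `Prop` is minted; nothing of E / row 9 / MODEL-N is touched.
-/
import Mathlib.RepresentationTheory.Irreducible
import Summits.HodgeConjecture.HodgeCM.Model.Binders.IsotypicSummand

/-!
# Isotypic summands — representation form

For `ρ : Representation k G V` written as an INTERNAL direct sum of subrepresentations `H i`
(`DirectSum.IsInternal fun i => (H i).toSubmodule`), each IRREDUCIBLE, an intertwining map `f : σ →ᵢ ρ` from an
irreducible `σ` that is equivalent to no `H i` with `i ≠ i₀` has `f.range ≤ H i₀`
(`range_le_of_isInternal`); block form `iSup`-free: every such range lies in `H (t j)` for its own type.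
This is the printed shape of [Liu21, Prop. 4.13] («`≅ ⊕ ω(μ,ε,χ)` of `ℂ[U(𝕍)(𝔸_F^∞)]`-modules», summands irreducible,
mutually non-isomorphic by Thm. 4.18 (2) / the uniqueness clause in the proof of Prop. 4.13).
Proof: transport to `k[G]`-modules (`Representation.asModule`, `Subrepresentation.asSubmodule`,
`IntertwiningMap.equivLinearMapAsModule`) and apply `HodgeCM.IsotypicSummand.range_le_of_isInternal`. [folklore]
-/

noncomputable section

namespace HodgeCM.IsotypicSummand.Rep

open DirectSum Representation
open scoped MonoidAlgebra

variable {k G V W : Type*} [Field k] [Monoid G] [AddCommGroup V] [Module k V]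
  [AddCommGroup W] [Module k W] {ρ : Representation k G V} {σ : Representation k G W}

/-- The inclusion of a subrepresentation, as an intertwining map. [folklore] -/
def subtype (H : Subrepresentation ρ) : IntertwiningMap H.toRepresentation ρ where
  toLinearMap := H.toSubmodule.subtype
  isIntertwining' _ := rfl

/-- (Ported verbatim from the HodgeCMPerL package; no docstring in the source.) -/
@[simp] theorem subtype_apply (H : Subrepresentation ρ) (v : ↥H.toSubmodule) : subtype H v = (v : V) := rfl

/-- `k[G]`-linear form of the inclusion: `H.toRepresentation.asModule →ₗ[k[G]] ρ.asModule`. [folklore] -/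
def subtypeAsModule (H : Subrepresentation ρ) : H.toRepresentation.asModule →ₗ[k[G]] ρ.asModule :=
  IntertwiningMap.equivLinearMapAsModule _ _ (subtype H)

/-- (Ported verbatim from the HodgeCMPerL package; no docstring in the source.) -/
theorem subtypeAsModule_injective (H : Subrepresentation ρ) : Function.Injective (subtypeAsModule H) :=
  fun _ _ h => Subtype.val_injective h

/-- (Ported verbatim from the HodgeCMPerL package; no docstring in the source.) -/
theorem range_subtypeAsModule (H : Subrepresentation ρ) :
    LinearMap.range (subtypeAsModule H) = H.asSubmodule := by
  ext v
  constructor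
  · rintro ⟨w, rfl⟩
    exact w.2
  · intro hv
    exact ⟨⟨v, hv⟩, rfl⟩

/-- The `k[G]`-module of a subrepresentation IS its underlying `k[G]`-submodule of `ρ.asModule`. [folklore] -/
def asSubmoduleEquiv (H : Subrepresentation ρ) : H.toRepresentation.asModule ≃ₗ[k[G]] ↥H.asSubmodule :=
  (LinearEquiv.ofInjective _ (subtypeAsModule_injective H)).trans
    (LinearEquiv.ofEq _ _ (range_subtypeAsModule H))

/-- An irreducible subrepresentation has a simple underlying `k[G]`-submodule. [folklore] -/
theorem isSimpleModule_asSubmodule (H : Subrepresentation ρ) [H.toRepresentation.IsIrreducible] :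
    IsSimpleModule k[G] ↥H.asSubmodule :=
  IsSimpleModule.congr (asSubmoduleEquiv H).symm

/-- A `k[G]`-linear isomorphism of the module forms gives an equivalence of representations. [folklore] -/
def equivOfLinearEquivAsModule (e : σ.asModule ≃ₗ[k[G]] ρ.asModule) : σ.Equiv ρ :=
  IntertwiningMap.ofBijective ((IntertwiningMap.equivLinearMapAsModule σ ρ).symm e.toLinearMap) e.bijective

/-- **Isotypic summand, representation form.**  `ρ = ⨁ H i` internally, every `H i` irreducible; `σ` irreducible and
equivalent to no `H i` with `i ≠ i₀`; then every intertwining map `f : σ →ᵢ ρ` has `f.range ≤ H i₀`. [folklore] -/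
theorem range_le_of_isInternal {ι : Type*} [DecidableEq ι] (H : ι → Subrepresentation ρ)
    (hH : IsInternal fun i => (H i).toSubmodule) [∀ i, (H i).toRepresentation.IsIrreducible]
    [σ.IsIrreducible] {i₀ : ι} (hS : ∀ ⦃i : ι⦄, Nonempty (σ.Equiv (H i).toRepresentation) → i = i₀)
    (f : IntertwiningMap σ ρ) : f.range ≤ H i₀ := by
  have hH' : IsInternal fun i => (H i).asSubmodule := hH
  haveI : ∀ i, IsSimpleModule k[G] ↥(H i).asSubmodule := fun i => isSimpleModule_asSubmodule (H i)
  have hS' : ∀ ⦃i : ι⦄, Nonempty (σ.asModule ≃ₗ[k[G]] ↥(H i).asSubmodule) → i = i₀ := fun i ⟨e⟩ =>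
    hS ⟨equivOfLinearEquivAsModule (e.trans (asSubmoduleEquiv (H i)).symm)⟩
  have h := HodgeCM.IsotypicSummand.range_le_of_isInternal (fun i => (H i).asSubmodule) hH' hS'
    (IntertwiningMap.equivLinearMapAsModule σ ρ f)
  intro v hv
  have hv' : v ∈ LinearMap.range f.toLinearMap := hv
  obtain ⟨w, rfl⟩ := hv'
  exact h ⟨w, rfl⟩

/-- Membership form. [folklore] -/
theorem apply_mem_of_isInternal {ι : Type*} [DecidableEq ι] (H : ι → Subrepresentation ρ)
    (hH : IsInternal fun i => (H i).toSubmodule) [∀ i, (H i).toRepresentation.IsIrreducible]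
    [σ.IsIrreducible] {i₀ : ι} (hS : ∀ ⦃i : ι⦄, Nonempty (σ.Equiv (H i).toRepresentation) → i = i₀)
    (f : IntertwiningMap σ ρ) (w : W) : f w ∈ H i₀ :=
  range_le_of_isInternal H hH hS f (show f w ∈ LinearMap.range f.toLinearMap from ⟨w, rfl⟩)

/-- PAIRWISE NON-EQUIVALENT summands: a summand-typed source. [folklore] -/
theorem range_le_of_isInternal_of_equiv {ι : Type*} [DecidableEq ι] (H : ι → Subrepresentation ρ)
    (hH : IsInternal fun i => (H i).toSubmodule) [∀ i, (H i).toRepresentation.IsIrreducible]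
    (hW : ∀ ⦃i j : ι⦄, Nonempty ((H i).toRepresentation.Equiv (H j).toRepresentation) → i = j)
    [σ.IsIrreducible] {i₀ : ι} (e : σ.Equiv (H i₀).toRepresentation) (f : IntertwiningMap σ ρ) :
    f.range ≤ H i₀ :=
  range_le_of_isInternal H hH (fun _ hi => (hW ⟨e.symm.trans (Classical.choice hi)⟩).symm) f

/-- BLOCK form (the μ-block of [Liu21, Thm. 4.18]): intertwining maps `f j : σ j →ᵢ ρ` from irreducibles of types
`t j ∈ B` all land in `⨆ i ∈ B, (H i).toSubmodule`. [folklore] -/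
theorem range_le_biSup_of_isInternal {ι : Type*} [DecidableEq ι] (H : ι → Subrepresentation ρ)
    (hH : IsInternal fun i => (H i).toSubmodule) [∀ i, (H i).toRepresentation.IsIrreducible]
    (hW : ∀ ⦃i j : ι⦄, Nonempty ((H i).toRepresentation.Equiv (H j).toRepresentation) → i = j)
    {J : Type*} {U : J → Type*} [∀ j, AddCommGroup (U j)] [∀ j, Module k (U j)]
    (σ : ∀ j, Representation k G (U j)) [∀ j, (σ j).IsIrreducible] (t : J → ι)
    (e : ∀ j, (σ j).Equiv (H (t j)).toRepresentation) (f : ∀ j, IntertwiningMap (σ j) ρ) {B : Set ι}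
    (hB : ∀ j, t j ∈ B) (j : J) : (f j).range.toSubmodule ≤ ⨆ i ∈ B, (H i).toSubmodule :=
  fun _ hx => (le_biSup (fun i => (H i).toSubmodule) (hB j))
    (range_le_of_isInternal_of_equiv H hH hW (e j) (f j) hx)

end HodgeCM.IsotypicSummand.Rep

end
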